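import Literature.NumberTheory.QuadraticFields.RedeiReichardtPrincipalAmbiguous
import Literature.NumberTheory.QuadraticFields.RedeiMatrixFourRank
import Literature.NumberTheory.QuadraticFields.AmbiguousClasses
import Mathlib.SetTheory.Cardinal.Finite
import HarnessLib

/-!
# The `2 : 1` parametrisation `e ↦ ∏ [𝔭ᵢ]^{eᵢ}` of `Cl(ℚ(√-n))[2]` by the subsets of the ramified primes

Topic `NumberTheory/QuadraticFields`, namespace `Literature.NumberTheory.QuadraticFields.RedeiReichardt`
(towards `redeiReichardt_fourTwoCard_classGroup`, Li–Ma 2008 Thm. 0.4 / Stevenhagen 1995 §2).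
Theorem-only file (no definition, no named fact).

For `K ∋ √-n` imaginary quadratic with ramified primes `𝔭₁, …, 𝔭_t` (`𝔭ᵢ² = (pᵢ)`, `p₁, …, p_t` the
primes of `disc K`, Li–Ma Lemma 0.1), the homomorphism

  `φ : 𝔽₂^t → Cl_K`, `e ↦ ∏ᵢ [𝔭ᵢ]^{eᵢ}`,

has **kernel of order `2`** and **image exactly `Cl_K[2]`** (`exists_parametrisation`).  Proof:
`im φ ⊆ Cl_K[2]`, which has `2^{t-1}` elements (Gauss, the tree's `card_sq_eq_one_classGroup`), so
`#ker φ ≥ 2`; conversely a principal `∏ 𝔭ᵢ^{eᵢ}` has `e ∈ {0, r}`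
(`eq_zero_or_eq_indicator_of_isPrincipal`; for `n ∈ {1, 3}` one has `t = 1`), so `#ker φ = 2` and
`#im φ = 2^{t-1}`.  (Stevenhagen §2: the `2^t` ideals `∏ 𝔭ᵢ^{eᵢ}` represent each ambiguous class
exactly twice.)

## References

* P. Stevenhagen, *Rédei-matrices and applications*, LMS LNS 215 (1995), §2. [Stevenhagen1995RedeiMatrices]
* Y. Li, L. Ma, Acta Arith. 134 (2008), Lemma 0.1, Thm. 0.4. [LiMa2008]
* D. A. Cox, *Primes of the form x² + ny²*, 2nd ed. (2013), Prop. 3.11 (`#Cl[2] = 2^{t-1}`). [Cox2013]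
-/

noncomputable section

open NumberField Ideal Module
open scoped nonZeroDivisors Pointwise

namespace Literature.NumberTheory.QuadraticFields.RedeiReichardt

open Literature.NumberTheory.QuadraticFields.Quadratic

section Setup

variable {K : Type*} [Field K] [NumberField K] (h2 : finrank ℚ K = 2)
  {n : ℕ} {x : 𝓞 K} (hx : x ^ 2 = -(n : 𝓞 K))
  {t : ℕ} {p : Fin t → ℕ} (hp : ∀ i, (p i).Prime) (hinj : Function.Injective p)
  (hprod : ∏ i, p i = if n % 4 = 1 then 2 * n else n)
  {P : Fin t → Ideal (𝓞 K)} (hP : ∀ i, P i ^ 2 = span {(p i : 𝓞 K)})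

include h2 hx hp hinj hprod in
/-- **Gauss's count in the coordinates of the tuple**: `#Cl_K[2] = 2^{t-1}`.
[cite: Cox2013, §3.B Prop. 3.11] [cite: LiMa2008, Thm. 0.4 (p. 280: "the 2-rank of Cl_K equals t − 1")] -/
theorem natCard_sq_eq_one_eq : Nat.card {c : ClassGroup (𝓞 K) // c ^ 2 = 1} = 2 ^ (t - 1) := by
  obtain ⟨hn, hn0⟩ := squarefree_and_pos_of_prod_eq hp hinj hprod
  have hxK : ((x : 𝓞 K) : K) ^ 2 = -(n : K) := by
    have h := congrArg (fun y : 𝓞 K => (y : K)) hx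
    simpa using h
  rw [card_sq_eq_one_classGroup (isImaginaryQuadratic h2 hn hxK), natAbs_discr_eq h2 hn hxK,
    ← card_eq_card_primeFactors hp hinj hprod]

include h2 hx hp hinj hprod hP in
/-- **The `2 : 1` parametrisation of `Cl_K[2]`**: the homomorphism `e ↦ ∏ [𝔭ᵢ]^{eᵢ}` from `𝔽₂^t`
(written multiplicatively) to `Cl_K` has kernel of order `2` and image `{a : a² = 1}`.
[cite: Stevenhagen1995RedeiMatrices, §2 (proof of Thm. 1)] [cite: LiMa2008, Thm. 0.4] -/
theorem exists_parametrisation :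
    ∃ φ : Multiplicative (Fin t → ZMod 2) →* ClassGroup (𝓞 K),
      (∀ e : Fin t → ZMod 2, φ (Multiplicative.ofAdd e) =
          ∏ i, ClassGroup.mk0 ⟨P i, mem_nonZeroDivisors_of_sq_eq_span h2 (hp i) (hP i)⟩ ^ (e i).val) ∧
      Nat.card φ.ker = 2 ∧ ∀ a : ClassGroup (𝓞 K), a ^ 2 = 1 ↔ a ∈ φ.range := by
  classical
  obtain ⟨hn, hn0⟩ := squarefree_and_pos_of_prod_eq hp hinj hprod
  have ht : 0 < t := pos_of_prod_eq hprod
  -- the classes `cᵢ = [𝔭ᵢ]`, of square `1`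
  set c : Fin t → ClassGroup (𝓞 K) := fun i =>
    ClassGroup.mk0 ⟨P i, mem_nonZeroDivisors_of_sq_eq_span h2 (hp i) (hP i)⟩ with hc
  have hc2 : ∀ i, c i ^ 2 = 1 := fun i => mk0_sq_eq_one_of_sq_eq_span (hp i) (hP i) _
  have hcmod : ∀ i (m : ℕ), c i ^ m = c i ^ (m % 2) := fun i m => by
    conv_lhs => rw [← Nat.mod_add_div m 2, pow_add, pow_mul, hc2 i, one_pow, mul_one]
  -- the homomorphism
  set ψ : (Fin t → ZMod 2) → ClassGroup (𝓞 K) := fun e => ∏ i, c i ^ (e i).val with hψ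
  have hψ0 : ψ 0 = 1 := by simp [hψ]
  have hψadd : ∀ e e', ψ (e + e') = ψ e * ψ e' := fun e e' => by
    simp only [hψ, ← Finset.prod_mul_distrib, ← pow_add]
    refine Finset.prod_congr rfl fun i _ => ?_
    rw [Pi.add_apply, ZMod.val_add, ← hcmod]
  let φ : Multiplicative (Fin t → ZMod 2) →* ClassGroup (𝓞 K) :=
    { toFun := fun v => ψ (Multiplicative.toAdd v)
      map_one' := hψ0
      map_mul' := fun v w => by rw [toAdd_mul, hψadd] }
  have hφsq : ∀ v, φ v ^ 2 = 1 := fun v => by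
    change ψ (Multiplicative.toAdd v) ^ 2 = 1
    simp only [hψ, ← Finset.prod_pow]
    exact Finset.prod_eq_one fun i _ => by rw [← pow_mul, mul_comm, pow_mul, hc2, one_pow]
  -- cardinalities: `#V = 2^t`, `#V = #ker · #range`, `#range ≤ #Cl[2] = 2^{t-1}`
  have hV : Nat.card (Multiplicative (Fin t → ZMod 2)) = 2 ^ t := by
    rw [Nat.card_eq_fintype_card, Fintype.card_multiplicative, Fintype.card_fun, ZMod.card,
      Fintype.card_fin]
  have hmul : Nat.card φ.ker * Nat.card φ.range = 2 ^ t := by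
    rw [← Subgroup.index_ker, Subgroup.card_mul_index, hV]
  have htors := natCard_sq_eq_one_eq h2 hx hp hinj hprod
  let ι : φ.range → {a : ClassGroup (𝓞 K) // a ^ 2 = 1} := fun a => ⟨a.1, by
    obtain ⟨v, hv⟩ := a.2
    rw [← hv]; exact hφsq v⟩
  have hιinj : Function.Injective ι := fun a b h => by
    have h' := congrArg (fun z : {a : ClassGroup (𝓞 K) // a ^ 2 = 1} => (z.1 : ClassGroup (𝓞 K))) h
    exact Subtype.ext h'
  have hrange_le : Nat.card φ.range ≤ 2 ^ (t - 1) := htors ▸ Nat.card_le_card_of_injective ι hιinj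
  -- `#ker ≥ 2`
  have hker_ge : 2 ≤ Nat.card φ.ker := by
    by_contra hlt
    have hk1 : Nat.card φ.ker ≤ 1 := by omega
    have h1 : 2 ^ t ≤ 2 ^ (t - 1) := by
      calc 2 ^ t = Nat.card φ.ker * Nat.card φ.range := hmul.symm
        _ ≤ 1 * 2 ^ (t - 1) := Nat.mul_le_mul hk1 hrange_le
        _ = 2 ^ (t - 1) := one_mul _
    have h2' : 2 ^ (t - 1) < 2 ^ t := Nat.pow_lt_pow_right (by norm_num) (by omega)
    omega
  -- `#ker ≤ 2`
  have hker_le : Nat.card φ.ker ≤ 2 := by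
    by_cases h13 : n = 1 ∨ n = 3
    · -- then `t = 1` and `#V = 2`
      have ht1 : t = 1 := by
        rw [card_eq_card_primeFactors hp hinj hprod]
        rcases h13 with rfl | rfl
        · show (if 1 % 4 = 3 then 1 else 4 * 1).primeFactors.card = 1
          rw [if_neg (by norm_num), show 4 * 1 = 2 ^ 2 by norm_num,
            Nat.primeFactors_prime_pow two_ne_zero Nat.prime_two, Finset.card_singleton]
        · show (if 3 % 4 = 3 then 3 else 4 * 3).primeFactors.card = 1
          rw [if_pos (by norm_num), Nat.Prime.primeFactors Nat.prime_three, Finset.card_singleton]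
      calc Nat.card φ.ker ≤ Nat.card (Multiplicative (Fin t → ZMod 2)) :=
            Nat.card_le_card_of_injective _ Subtype.val_injective
        _ = 2 := by rw [hV, ht1, pow_one]
    · push Not at h13
      -- `ker ⊆ {0, r}`: inject into `Bool` by `v ↦ (v = 1)`
      refine le_trans (Nat.card_le_card_of_injective (fun v : φ.ker => decide (v.1 = 1)) ?_) ?_
      · intro v w hvw
        have key : ∀ u : φ.ker, u.1 ≠ 1 →
            Multiplicative.toAdd u.1 = fun i => if p i ∣ n then 1 else 0 := by
          intro u hu
          have hker : φ u.1 = 1 := u.2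
          have hprinc : (∏ i, P i ^ ((Multiplicative.toAdd u.1) i).val).IsPrincipal := by
            have h1 : ψ (Multiplicative.toAdd u.1) = 1 := hker
            simp only [hψ, hc, ← map_pow, ← map_prod] at h1
            rw [ClassGroup.mk0_eq_one_iff] at h1
            convert h1 using 2
            simp
          rcases eq_zero_or_eq_indicator_of_isPrincipal h2 hx hp hinj hprod hP h13.1 h13.2 _ hprinc
            with h0 | hr
          · exact absurd (show u.1 = 1 from h0) hu
          · exact hr
        by_cases hv1 : v.1 = 1
        · by_cases hw1 : w.1 = 1
          · exact Subtype.ext (hv1.trans hw1.symm)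
          · simp [hv1, hw1] at hvw
        · by_cases hw1 : w.1 = 1
          · simp [hv1, hw1] at hvw
          · exact Subtype.ext (show v.1 = w.1 from (key v hv1).trans (key w hw1).symm)
      · simp
  have hker : Nat.card φ.ker = 2 := le_antisymm hker_le hker_ge
  -- hence `#range = 2^{t-1}` and the range is all of `Cl[2]`
  have hrange : Nat.card φ.range = 2 ^ (t - 1) := by
    have h : 2 * Nat.card φ.range = 2 ^ t := by
      have h0 := hmul
      rwa [hker] at h0
    have h2t : 2 ^ t = 2 * 2 ^ (t - 1) := by
      rw [← pow_succ']
      congr 1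
      omega
    omega
  have hιbij : Function.Bijective ι :=
    hιinj.bijective_of_nat_card_le (by rw [htors, hrange])
  refine ⟨φ, fun e => rfl, hker, fun a => ⟨fun ha => ?_, ?_⟩⟩
  · obtain ⟨b, hb⟩ := hιbij.2 ⟨a, ha⟩
    have : (b.1 : ClassGroup (𝓞 K)) = a := congrArg Subtype.val hb
    rw [← this]; exact b.2
  · rintro ⟨v, rfl⟩
    exact hφsq v

end Setup

end Literature.NumberTheory.QuadraticFields.RedeiReichardt

end
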